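import Mathlib
import HarnessLib
import Summits.HubbardSuperconductivity.HubbardSuperconductivity.Theorems.KLProgrammeH10TwoPointLimitFramePerturbation
import Summits.HubbardSuperconductivity.HubbardSuperconductivity.Theorems.KLProgrammeKLRegimeEngineWtBudget

/-!
# Route `KLProgramme` — crux K3, VL child `KLRegimeVolumeLimitV17F2` (stmt-HubbardSuperconductivity-20440), skeleton «cauchy» v11: THE RUNNING COUPLING IN THE
# REGIME AND THE `U₀/c₅` DOORS OF THE ASSEMBLER (seat hubbard-kl-k3c4-p1 g15; `--supports` 20440)

`…TowerDataTSOfReadouts.towerDataTS_of_readouts` asks four scale-free inequalities of the shape `ε_{j+1}·B ≤ 1` (resp. `≤ k₀²`, `≤ εb`) for `j ≤ n_β`,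
`ε_n = Klam·(|U| + U²·n)`.  In the regime `klBetaMin ≤ β ≤ exp(c/U²)` one has `U²·(n_β+1) ≤ c/log 4` (`PerturbedFermiCurve.sq_mul_nScales_succ_le`), hence
`ε_{j+1} ≤ Klam·(|U| + c/log 4)` for every `j ≤ n_β` (`epsCoupling_succ_le_of_regime`), and `ε_{j+1}·B ≤ 1` as soon as `2·Klam·B·|U| ≤ 1` and
`2·Klam·B·c/log 4 ≤ 1` (`epsCoupling_succ_mul_le_one_of_doors`); the doors `U₀ := 1/(2·Klam·B + 1)`, `c₅ := log 4/(2·Klam·B + 1)` do it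
(`exists_doors_epsCoupling_succ_mul_le_one`).  Also `epsCoupling_pos_of_ne` (`0 < ε_n` for `Klam > 0`, `U ≠ 0`).

Proofs only; no definition; elementary. [cite: BenfattoGiulianiMastropietro2006, §2.7 (2.77)-(2.80)]
-/

noncomputable section

namespace Summit.HubbardSuperconductivity.HubbardSuperconductivity.Theorems.TwoVolumeSource

set_option linter.dupNamespace false -- summit = problem name (single-conjunct summit), D-0017

open Summit.HubbardSuperconductivity.HubbardSuperconductivity.Theorems.KLProgrammeLegKernels
open Summit.HubbardSuperconductivity.HubbardSuperconductivity.Theorems.KLRegimeSplit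
open Summit.HubbardSuperconductivity.HubbardSuperconductivity.Theorems.EngineV8

/-- **`ε_n > 0`** for `Klam > 0`, `U ≠ 0`. [folklore] -/
theorem epsCoupling_pos_of_ne {P : SplitConsts} (hK : 0 < P.Klam) {U : ℝ} (hU : U ≠ 0) (n : ℕ) : 0 < epsCoupling P U n := by
  unfold epsCoupling
  have h1 : 0 < |U| := abs_pos.2 hU
  have h2 : 0 ≤ U ^ 2 * n := by positivity
  exact mul_pos hK (by linarith)

/-- **The running coupling in the regime**: `klBetaMin ≤ β ≤ exp(c/U²)`, `0 ≤ c`, `j ≤ n_β` give `ε_{j+1} ≤ Klam·(|U| + c/log 4)`.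
[cite: BenfattoGiulianiMastropietro2006, §2.7 (2.77)-(2.80)] -/
theorem epsCoupling_succ_le_of_regime {P : SplitConsts} (hK : 0 ≤ P.Klam) {U c β : ℝ} (hc : 0 ≤ c) (hβ : klBetaMin ≤ β) (hβc : β ≤ Real.exp (c / U ^ 2))
    {j : ℕ} (hj : j ≤ nScales β) : epsCoupling P U (j + 1) ≤ P.Klam * (|U| + c / Real.log 4) := by
  have h := PerturbedFermiCurve.sq_mul_nScales_succ_le hc hβ hβc
  unfold epsCoupling
  refine mul_le_mul_of_nonneg_left ?_ hK
  have hle : (((j + 1 : ℕ) : ℝ)) ≤ (nScales β : ℝ) + 1 := by push_cast; exact_mod_cast Nat.succ_le_succ hj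
  have h1 : U ^ 2 * (((j + 1 : ℕ) : ℝ)) ≤ U ^ 2 * ((nScales β : ℝ) + 1) := mul_le_mul_of_nonneg_left hle (sq_nonneg U)
  linarith

/-- **`ε_{j+1}·B ≤ 1` from the two doors** `2·Klam·B·|U| ≤ 1`, `2·Klam·B·(c/log 4) ≤ 1` (`j ≤ n_β` in the regime, `B ≥ 0`). [folklore] -/
theorem epsCoupling_succ_mul_le_one_of_doors {P : SplitConsts} (hK : 0 ≤ P.Klam) {U c β B : ℝ} (hB : 0 ≤ B) (hc : 0 ≤ c) (hβ : klBetaMin ≤ β)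
    (hβc : β ≤ Real.exp (c / U ^ 2)) (hUdoor : 2 * P.Klam * B * |U| ≤ 1) (hcdoor : 2 * P.Klam * B * (c / Real.log 4) ≤ 1)
    {j : ℕ} (hj : j ≤ nScales β) : epsCoupling P U (j + 1) * B ≤ 1 := by
  have h := epsCoupling_succ_le_of_regime hK hc hβ hβc hj
  calc epsCoupling P U (j + 1) * B ≤ P.Klam * (|U| + c / Real.log 4) * B := mul_le_mul_of_nonneg_right h hB
    _ = (2 * P.Klam * B * |U|) / 2 + (2 * P.Klam * B * (c / Real.log 4)) / 2 := by ring
    _ ≤ 1 / 2 + 1 / 2 := by gcongr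
    _ = 1 := by norm_num

/-- **The doors exist**: `U₀ := 1/(2·Klam·B + 1)`, `c₅ := log 4/(2·Klam·B + 1)` — positive, and `|U| ≤ U₀`, `0 ≤ c ≤ c₅` give `ε_{j+1}·B ≤ 1` for every `j ≤ n_β`
in the regime. [folklore] -/
theorem exists_doors_epsCoupling_succ_mul_le_one {P : SplitConsts} (hK : 0 ≤ P.Klam) {B : ℝ} (hB : 0 ≤ B) :
    ∃ c₅ : ℝ, 0 < c₅ ∧ ∃ U₀ : ℝ, 0 < U₀ ∧ ∀ c, 0 ≤ c → c ≤ c₅ → ∀ U : ℝ, |U| ≤ U₀ → ∀ β, klBetaMin ≤ β → β ≤ Real.exp (c / U ^ 2) →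
      ∀ j, j ≤ nScales β → epsCoupling P U (j + 1) * B ≤ 1 := by
  have hlog : 0 < Real.log 4 := Real.log_pos (by norm_num)
  have hd : 0 < 2 * P.Klam * B + 1 := by positivity
  refine ⟨Real.log 4 / (2 * P.Klam * B + 1), by positivity, 1 / (2 * P.Klam * B + 1), by positivity, ?_⟩
  intro c hc0 hc U hU β hβ hβc j hj
  have hKB : 0 ≤ 2 * P.Klam * B := by positivity
  refine epsCoupling_succ_mul_le_one_of_doors hK hB hc0 hβ hβc ?_ ?_ hj
  · calc 2 * P.Klam * B * |U| ≤ 2 * P.Klam * B * (1 / (2 * P.Klam * B + 1)) := mul_le_mul_of_nonneg_left hU hKB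
      _ ≤ 1 := by rw [mul_one_div, div_le_one hd]; linarith
  · have hc' : c / Real.log 4 ≤ 1 / (2 * P.Klam * B + 1) := by
      rw [div_le_iff₀ hlog]
      calc c ≤ Real.log 4 / (2 * P.Klam * B + 1) := hc
        _ = 1 / (2 * P.Klam * B + 1) * Real.log 4 := by ring
    calc 2 * P.Klam * B * (c / Real.log 4) ≤ 2 * P.Klam * B * (1 / (2 * P.Klam * B + 1)) := mul_le_mul_of_nonneg_left hc' hKB
      _ ≤ 1 := by rw [mul_one_div, div_le_one hd]; linarith

end Summit.HubbardSuperconductivity.HubbardSuperconductivity.Theorems.TwoVolumeSource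

end
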